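import Literature.AlgebraicGeometry.ShimuraVarieties.UnitaryBallHolomorphicPullback
import Literature.AlgebraicGeometry.ShimuraVarieties.UnitaryBallGroupForms
import Literature.AlgebraicGeometry.ShimuraVarieties.UnitaryBallGroupIntegralRecord
import Literature.Geometry.ComplexHyperbolic.UnitBallU21Borel
import Literature.AlgebraicGeometry.Motives.HodgeDecomposition
import Literature.NumberTheory.Transcendental.FormIntegration
import Mathlib.MeasureTheory.Group.FundamentalDomain
import Mathlib.MeasureTheory.Group.Measure
import HarnessLib

/-!
# The Petersson–wedge formula for compact ball quotients (OPEN junction hypothesis)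

Setting: `D : UnitaryBallUniformisationDatum 2 X₂` (so `X₂^an = Γ \ 𝔹²` through the uniformisation
`ψ = D.modelUnif A 𝔣 : 𝔹² → X₂^an` of the Hodge model `A : HodgeModel 2 X₂`, in a Sylvester frame
`𝔣`, with `Δ := ρ_𝔣(Γ) ≤ U(2,1)` — here `D.ballImage 𝔣` — acting on `𝔹²`), `j(g, z) = det Jac g z`
the canonical automorphy factor (`BallForms.canonicalFactor`), and for a holomorphic `2`-form
`α ∈ Ω²(X₂^an)` the automorphic form `F_α := ψ^* α ∈ 𝒜_hol(Γ, j)` (`D.holFormPullback₂ A 𝔣 ⊤ α`,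
i.e. `ψ^* α = F_α dz₀ ∧ dz₁`). The group-side lift is `φ_F(u) = j(u, x₀) F(u · x₀)`
(`AutomorphyFactor.toGroupFun`, `BallForms.groupLift`, Baily's `′F` = `BallForms.primeLift 1 F`),
and the pairing integrand is `BallForms.liftPairing 1 F′ F u = conj (φ_{F′} u) · φ_F u`
(`UnitaryBallGroupForms`), a left `Δ`-invariant function on `U(2,1)`
(`BallForms.liftPairing_mul_left`).

This file NAMES two statements, each a `Prop` to be taken as a HYPOTHESIS by its users:

* `D.PeterssonWedgeFormula A 𝔣 o μ` (**the junction hypothesis of the `L²`-embedding chain**,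
  registry node N-D2 of the pub-hodgecm model construction): for a continuous orientation `o` of
  `X₂^an` and a Haar measure `μ` on `U(2,1)` there is ONE constant `c ≠ 0` such that for every
  measurable fundamental domain `𝓕 ⊆ U(2,1)` for the LEFT translation action of `Δ` (Mathlib:
  `IsFundamentalDomain Δ 𝓕 μ`) and all `α, α′ ∈ Ω²(X₂^an)`,
  `∫_{u ∈ 𝓕} liftPairing 1 F_{α′} F_α (u) dμ(u) = c · ∫_{X₂^an} α ∧ ᾱ′` (the printed shape
  `∫_{Δ \ G} conj(′F′) ′F dġ` of a Petersson product);
* `D.BallWedgeFormula A 𝔣 o` (**the uniformisation change of variables**): there is ONE constant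
  `c ≠ 0` such that for every measurable fundamental domain `𝓕_D ⊆ 𝔹²` of `Δ` for Lebesgue
  measure and all `α, α′`, `∫_{𝓕_D} conj(F_{α′}) F_α dv = c · ∫_{X₂^an} α ∧ ᾱ′`.

**STATUS: OPEN JUNCTION HYPOTHESES — internal statements, NOT published theorems, NOT
kernel-proved in this file; no citation is attached to either declaration.** They are counted by
their consumers as open inputs until discharged. PLACEMENT (carver RULING P-1, 2026-08-18): these
two `Prop`s are internal open junction hypotheses of the PerL model construction — NOT reproduced
published material; their placement under `Literature/` (beside the kernel theorem
`UnitaryBallPeterssonDescent.PeterssonWedgeFormula_of` that composes them) is grandfathered by that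
ruling; they belong with the PerL model constructions and migrate with them if a
`Summits/HodgeConjecture/PerL/Model/` gate target opens. DISCHARGE PLAN (the package's RULING
N-D2-honest; motivation and provenance only — nothing below is asserted by this file):

1. PRINT (record, `UnitaryBallGroupIntegralRecord`): `BallForms.Baily1973_10_3 μ` — W. L. Baily,
   Jr., *Introductory Lectures on Automorphic Forms* (1973), Ch. 10 §3 (15), (19), (20),
   pp. 182–183: for every measurable `f` on `D`, with `′f(g) = j(g, z₀)^l f(g · z₀)`,
   "the integral in (19) [`∫_G |′f|^p dg`] is a constant multiple of that in (20)
   [`∫_D |f K_D^{-l/2}|^p dβ`]", at `(𝔹², U(2,1), x₀, l = 1, p = 2)`; with the cancellation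
   `K_D⁻¹ dβ = (9π²/2) dv` on `𝔹²` this reads `∫_{U(2,1)} |′f|² dμ = c′ ∫_{𝔹²} |f|² dv`
   (`Baily1973_10_3.lintegral_primeLift_sq`).
2. KERNEL (polarisation): the quadratic identity of 1. for `f, f′, f ± f′, f ± i f′` gives
   `∫_{U(2,1)} conj(′f′) ′f dμ = c′ ∫_{𝔹²} conj(f′) f dv` for square-integrable `f, f′`.
3. KERNEL (unfolding / `Γ`-descent): for a measurable fundamental domain `𝓕_D ⊆ 𝔹²` of `Δ`,
   `π⁻¹(𝓕_D)` (`π(u) = u · x₀`) is a fundamental domain for the LEFT translation action of `Δ` on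
   `U(2,1)`, and `′(1_{𝓕_D} F) = 1_{π⁻¹ 𝓕_D} · ′F`; so 2. applied to `1_{𝓕_D} F_α, 1_{𝓕_D} F_{α′}`
   gives `∫_{π⁻¹ 𝓕_D} liftPairing 1 F_{α′} F_α dμ = c′ ∫_{𝓕_D} conj(F_{α′}) F_α dv`; any two
   measurable fundamental domains of `Δ` in `U(2,1)` give the same integral of the `Δ`-invariant
   integrand (`MeasureTheory.IsFundamentalDomain.setIntegral_eq`; this discharges the `∀ 𝓕`
   quantifier).
4. `D.BallWedgeFormula A 𝔣 o` (KERNEL elsewhere in the package: the chart formula for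
   `MForm.integral` along the local inverses of `ψ`, `UnitaryBallLocalBiholomorphy`; J. M. Lee,
   *Introduction to Smooth Manifolds*, 2nd ed., Prop. 16.8 (16.3) "`∫_M ω = Σ ∫_{D_i} F_i^* ω`" is
   the printed shape of that step).

Then `PeterssonWedgeFormula` follows from 1.–4. (`c = c′ · c₄`). Steps 2.–3. and the composition
are not in this file.

Convention: the consumer (the `L²`-embedding chain) meets this LEFT-fundamental-domain form
through `LevelOrbit.setIntegral_comp_inv_eq_smul_of_invariant_left` (its descended lift is
`⟦u⟧ ↦ φ_F(u⁻¹)` on `U(2,1) ⧸ Δ`; `u ↦ u⁻¹` exchanges right and left fundamental domains and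
preserves the Haar measure of `U(2,1)`, unimodular as it has a cocompact lattice —
`LevelOrbit.isInvInvariant_of_compactSpace_quotient`).

Design notes. (i) ONE constant `c` for all `α, α′` and all fundamental domains; `c` depends on
`μ` and `o` (and on the sign conventions of `MForm.wedge`, `MForm.conj`, `cintegral`), which is
why no numerical value is asserted. (ii) `X₂^an` is compact and connected (`ψ` is onto), so
`Δ \ U(2,1)` is compact, the integrand — continuous and `Δ`-invariant — is bounded, `μ 𝓕 < ∞`, and
a continuous orientation of the connected `X₂^an` is unique up to a global sign: no junk values
enter. (iii) Also here (KERNEL): `ballImage`, and the left/right `Δ`-invariance of the pairing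
integrand (`liftPairing_holAutForms_mul_left`, `liftPairing_holAutForms_inv_mul_right`).
-/

noncomputable section

open Matrix MulAction Function Set Filter MeasureTheory
open scoped Manifold Topology ComplexConjugate
open Literature.Geometry.ComplexHyperbolic
open Literature.Geometry.ComplexHyperbolic.BallModel (U21 Ball Jac x₀ nsq actVec)
open Literature.Geometry.Kaehler (MForm IsHolomorphicInCharts holFormsInCharts)
open Literature.NumberTheory.Transcendental
open Literature.NumberTheory.Automorphic.AutomorphyFactor
open Literature.AlgebraicGeometry.HodgeTheory (HodgeModel)
open Literature.AlgebraicGeometry.Motives (cintegral)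

namespace Literature.AlgebraicGeometry.ShimuraVarieties

namespace UnitaryBallUniformisationDatum

variable {X₂ : Motives.SchemeOver ℂ} (D : UnitaryBallUniformisationDatum 2 X₂) (A : HodgeModel 2 X₂)
  (𝔣 : D.SylvesterFrame)

/-- The image `Δ = ρ_𝔣(Γ) ≤ U(2,1)` of the whole arithmetic group in the frame `𝔣` (the group
whose automorphic forms are `D.holAutForms 𝔣 ⊤ _`). [folklore] -/
def ballImage : Subgroup U21 := (⊤ : Subgroup D.Γ).map (D.ballRep 𝔣)

/-- `holAutForms 𝔣 ⊤ Aut` is the space of holomorphic forms for `ballImage`. [folklore] -/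
theorem holAutForms_top_eq (Aut : U21 → Ball → Module.End ℂ ℂ) :
    D.holAutForms 𝔣 ⊤ Aut = BallForms.holFactorForms (D.ballImage 𝔣) Aut := rfl

/-- The pairing integrand `u ↦ liftPairing 1 F′ F u` of two forms `F, F′ ∈ 𝒜_hol(Γ, j)` is left
`ρ_𝔣(Γ)`-invariant. [cite: Baily1973, Ch. 10 §3 (18) p. 183] -/
theorem liftPairing_holAutForms_mul_left
    (F' F : D.holAutForms 𝔣 ⊤ (BallForms.canonicalCocycle ℂ 1))
    {δ : U21} (hδ : δ ∈ D.ballImage 𝔣) (u : U21) :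
    BallForms.liftPairing 1 (F' : Ball → ℂ) (F : Ball → ℂ) (δ * u) =
      BallForms.liftPairing 1 (F' : Ball → ℂ) (F : Ball → ℂ) u :=
  BallForms.liftPairing_mul_left (BallForms.mem_holFactorForms_iff.mp F'.2).1
    (BallForms.mem_holFactorForms_iff.mp F.2).1 hδ u

/-- Hence `u ↦ liftPairing 1 F′ F u⁻¹` is right `ρ_𝔣(Γ)`-invariant (the form in which the
integrand descends to `U(2,1) ⧸ ρ_𝔣(Γ)` under the library's inversion convention). [folklore] -/
theorem liftPairing_holAutForms_inv_mul_right
    (F' F : D.holAutForms 𝔣 ⊤ (BallForms.canonicalCocycle ℂ 1))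
    {δ : U21} (hδ : δ ∈ D.ballImage 𝔣) (u : U21) :
    BallForms.liftPairing 1 (F' : Ball → ℂ) (F : Ball → ℂ) (u * δ)⁻¹ =
      BallForms.liftPairing 1 (F' : Ball → ℂ) (F : Ball → ℂ) u⁻¹ := by
  rw [_root_.mul_inv_rev]
  exact D.liftPairing_holAutForms_mul_left 𝔣 F' F (inv_mem hδ) u⁻¹

variable [MeasurableSpace A.model] [BorelSpace A.model] [Fact (Module.finrank ℝ A.model = 4)]

/-- **The Petersson–wedge formula for the compact ball quotient `X₂^an = Γ\𝔹²` (group-side)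
— OPEN JUNCTION HYPOTHESIS** (registry node N-D2): an internal statement, NOT a published theorem
and NOT proved in this library; its users take it as a hypothesis, and the package discharges it
by the plan in the module docstring (Baily's record `BallForms.Baily1973_10_3` + polarisation +
unfolding + `BallWedgeFormula`). Statement: for a continuous orientation `o` of `X₂^an` and a Haar
measure `μ` on `U(2,1)` there is `c ≠ 0` such that for every measurable fundamental domain `𝓕` of
the left translation action of `ρ_𝔣(Γ)` on `U(2,1)` and all holomorphic `2`-forms `α, α′` on
`X₂^an`, `∫_{u ∈ 𝓕} liftPairing 1 (ψ^*α′) (ψ^*α) u dμ = c ∫_{X₂^an} α ∧ ᾱ′`.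
[folklore] -/
def PeterssonWedgeFormula
    (o : (x : A.carrier) → Orientation ℝ (TangentSpace 𝓘(ℝ, A.model) x) (Fin 4))
    (μ : Measure U21) : Prop :=
  IsContinuousOrientation o → μ.IsHaarMeasure →
    ∃ c : ℂ, c ≠ 0 ∧
      ∀ 𝓕 : Set U21, MeasurableSet 𝓕 → IsFundamentalDomain (D.ballImage 𝔣) 𝓕 μ →
        ∀ α α' : holFormsInCharts A.model A.carrier 2,
          ∫ u in 𝓕, BallForms.liftPairing 1 (D.holFormPullback₂ A 𝔣 ⊤ α' : Ball → ℂ)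
              (D.holFormPullback₂ A 𝔣 ⊤ α : Ball → ℂ) u ∂μ =
            c * cintegral o ((α : MForm 𝓘(ℝ, A.model) A.carrier ℂ 2).wedge
              (α' : MForm 𝓘(ℝ, A.model) A.carrier ℂ 2).conj)

/-- **The uniformisation change of variables for `X₂^an = Γ\𝔹²` — OPEN JUNCTION HYPOTHESIS**
(step 4 of the discharge plan; proved in KERNEL elsewhere in the package, not here): for a
continuous orientation `o` of `X₂^an` there is `c ≠ 0` such that for every measurable fundamental
domain `𝓕_D ⊆ 𝔹²` of `ρ_𝔣(Γ)` for Lebesgue measure and all holomorphic `2`-forms `α, α′` on `X₂^an`,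
`∫_{𝓕_D} conj (ψ^*α′) · (ψ^*α) dv = c ∫_{X₂^an} α ∧ ᾱ′` (`ψ^*α = D.holFormPullback₂ A 𝔣 ⊤ α`, `dv`
Lebesgue measure `BallModel.ballVolume` of `UnitBallMeasure`). An internal statement, NOT a published theorem; a
hypothesis wherever used. [folklore] -/
def BallWedgeFormula
    (o : (x : A.carrier) → Orientation ℝ (TangentSpace 𝓘(ℝ, A.model) x) (Fin 4)) : Prop :=
  IsContinuousOrientation o →
    ∃ c : ℂ, c ≠ 0 ∧
      ∀ 𝓕 : Set Ball, MeasurableSet 𝓕 →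
        IsFundamentalDomain (D.ballImage 𝔣) 𝓕 BallModel.ballVolume →
          ∀ α α' : holFormsInCharts A.model A.carrier 2,
            ∫ z in 𝓕, conj ((D.holFormPullback₂ A 𝔣 ⊤ α' : Ball → ℂ) z) *
                (D.holFormPullback₂ A 𝔣 ⊤ α : Ball → ℂ) z ∂BallModel.ballVolume =
              c * cintegral o ((α : MForm 𝓘(ℝ, A.model) A.carrier ℂ 2).wedge
                (α' : MForm 𝓘(ℝ, A.model) A.carrier ℂ 2).conj)

end UnitaryBallUniformisationDatum

end Literature.AlgebraicGeometry.ShimuraVarieties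

end
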